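import Summits.Ventures.LatticeQCDFlow.Exactness.IMHEmpiricalAutocovBias
import Summits.Ventures.LatticeQCDFlow.Exactness.IMHColdStartMSE
import Summits.Ventures.LatticeQCDFlow.Exactness.IMHColdStartBurnIn
import HarnessLib

/-!
# The Γ-method's input from a cold start: the empirically centred lag sum of a cold-started exact sampler differs
# from its equilibrium expectation by at most `(δ² + V)(w + 3(2w² − w)/N)` — an `O(w/N)` bias of `Γ̂_u` at every lag

HONEST FRAMING: exact (Metropolis-corrected) sampling algorithms for lattice gauge theory;
figures of merit are autocorrelation/cost numbers at stated couplings and volumes; no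
continuum-physics claim.

Venture `LatticeQCDFlow` (cell pub-lqcd), topic `Exactness`; FANOUT row 30 (lean-1, GEN-33).  NEW WORK of the
cell, general state space.  `IMHEmpiricalAutocovBias` (this generation) computed `E_π[S_u]`,
`S_u = Σ_{i<N−u}(f(X_i) − m_N)(f(X_{i+u}) − m_N)`, exactly at equilibrium.  GEN-32 (`IMHColdStartAutocovBias`) had the
cold-started lag products centred at the TRUE mean only ("NOT CLAIMED: estimators centred at the empirical mean").
Here the cold start meets the empirical centring:

* §1 **`chain_lagSum_centred_eq_pairs`** — for EVERY Markov kernel and EVERY initial law `μ₀`: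
  `E_{μ₀}[S_u] = Σ_{i<M} p(i,i+u) − (1/N)Σ_{i<M}Σ_{k<N}(p(i,k) + p(i+u,k)) + M·E_{μ₀}[(m_N − π f)²]`, `M = N − u`, with the
  pair moments `p(i,j) = E_{μ₀}[f̄(X_i) f̄(X_j)]` (`f̄ = f − π f`).
* §2 flow-MCMC from the mode (`w = w(x₀)`, `r = 1 − 1/w`, `δ = f(x₀) − π f`, `V = Var_π f`; GEN-32's pair law
  `p_cold(i,j) = (1 − r^{min})γ_{|i−j|} + r^{max}δ²`, so `|p_cold(i,j) − γ_{|i−j|}| ≤ (δ² + V)·r^{max(i,j)}`):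
  **`imh_chain_lagSum_centred_mode_sub_stationary_abs_le`** —
  `|E_{x₀}[S_u] − E_π[S_u]| ≤ (δ² + V)·(w + 3(2w² − w)/N)` for every lag `u` and every `N ≥ 1`; hence
  (**`imh_chain_empiricalAutocov_mode_abs_le`**) the cold start moves the autocovariance ESTIMATOR `Γ̂_u = S_u/N` by at
  most `(δ² + V)(w + 3(2w² − w)/N)/N = O(w(δ² + V)/N)` — the same `1/N` order as the estimator's own equilibrium bias
  (`≤ 2(2w − 1)V/N`, `IMHEmpiricalAutocovBias`): empirical centring does not amplify the cold start.

NOT CLAIMED: the exact (signed) cold-start correction of `E[S_u]` in closed form (it is the explicit triple sum in the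
proof; only its envelope is stated); the windowed `τ̂_int` itself; non-modal starts.

No `sorry`, no new definitions, nothing cited as a fact; general measurable space with measurable singletons.
-/

noncomputable section

namespace Summit.Ventures.LatticeQCDFlow.Exactness

open MeasureTheory ProbabilityTheory Function Finset
open scoped ENNReal
open Summit.Ventures.LatticeQCDFlow.Scoring

variable {Ω : Type*} [MeasurableSpace Ω]

/-! ## §1 Any kernel, any start: the expected lag sum in terms of pair moments -/

/-- **`E_{μ₀}[S_u] = Σ_{i<M} p(i,i+u) − (1/N)Σ_{i<M}Σ_{k<N}(p(i,k) + p(i+u,k)) + M·E_{μ₀}[(m_N − m)²]`** for every Markov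
kernel, every initial law, bounded measurable `f`, constant `m`, `N ≥ 1`, `M = N − u`, `p(i,j) = E_{μ₀}[(f(X_i) − m)(f(X_j) − m)]`.
[ours] -/
theorem chain_lagSum_centred_eq_pairs (κ : Kernel Ω Ω) [IsMarkovKernel κ] (μ₀ : Measure Ω) [IsProbabilityMeasure μ₀]
    {f : Ω → ℝ} (hf : Measurable f) {C : ℝ} (hC : ∀ x, |f x| ≤ C) (m : ℝ) {N : ℕ} (hN : N ≠ 0) (u : ℕ) :
    ∫ x, ∑ i ∈ Finset.range (N - u), (f (x i) - (∑ j ∈ Finset.range N, f (x j)) / N) *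
        (f (x (i + u)) - (∑ j ∈ Finset.range N, f (x j)) / N)
        ∂(Kernel.trajMeasure (X := fun _ : ℕ => Ω) μ₀
          (fun n : ℕ => κ.comap (fun h : (i : ↥(Finset.Iic n)) → Ω => h ⟨n, Finset.mem_Iic.2 le_rfl⟩)
            (measurable_pi_apply _))) =
      ∑ i ∈ Finset.range (N - u), ∫ x, (f (x i) - m) * (f (x (i + u)) - m)
          ∂(Kernel.trajMeasure (X := fun _ : ℕ => Ω) μ₀
            (fun n : ℕ => κ.comap (fun h : (i : ↥(Finset.Iic n)) → Ω => h ⟨n, Finset.mem_Iic.2 le_rfl⟩)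
              (measurable_pi_apply _))) -
        (∑ i ∈ Finset.range (N - u), ∑ k ∈ Finset.range N,
            (∫ x, (f (x i) - m) * (f (x k) - m)
                ∂(Kernel.trajMeasure (X := fun _ : ℕ => Ω) μ₀
                  (fun n : ℕ => κ.comap (fun h : (i : ↥(Finset.Iic n)) → Ω => h ⟨n, Finset.mem_Iic.2 le_rfl⟩)
                    (measurable_pi_apply _))) +
              ∫ x, (f (x (i + u)) - m) * (f (x k) - m)
                ∂(Kernel.trajMeasure (X := fun _ : ℕ => Ω) μ₀
                  (fun n : ℕ => κ.comap (fun h : (i : ↥(Finset.Iic n)) → Ω => h ⟨n, Finset.mem_Iic.2 le_rfl⟩)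
                    (measurable_pi_apply _))))) / N +
        (N - u : ℕ) * ∫ x, ((∑ j ∈ Finset.range N, f (x j)) / N - m) ^ 2
          ∂(Kernel.trajMeasure (X := fun _ : ℕ => Ω) μ₀
            (fun n : ℕ => κ.comap (fun h : (i : ↥(Finset.Iic n)) → Ω => h ⟨n, Finset.mem_Iic.2 le_rfl⟩)
              (measurable_pi_apply _))) := by
  set P := Kernel.trajMeasure (X := fun _ : ℕ => Ω) μ₀
      (fun n : ℕ => κ.comap (fun h : (i : ↥(Finset.Iic n)) → Ω => h ⟨n, Finset.mem_Iic.2 le_rfl⟩)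
        (measurable_pi_apply _)) with hP
  set g : Ω → ℝ := fun x => f x - m with hgdef
  set M := N - u with hM
  have hN' : (N : ℝ) ≠ 0 := by exact_mod_cast hN
  have hgm : Measurable g := hf.sub measurable_const
  have hgb : ∀ x, |g x| ≤ C + |m| := fun x => (abs_sub _ _).trans (add_le_add (hC x) le_rfl)
  have hbar : ∀ x : ℕ → Ω, (∑ j ∈ Finset.range N, f (x j)) / N = m + (∑ j ∈ Finset.range N, g (x j)) / N := by
    intro x
    simp only [hgdef, Finset.sum_sub_distrib, Finset.sum_const, Finset.card_range, nsmul_eq_mul]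
    field_simp
    ring
  have hpt : ∀ x : ℕ → Ω, ∑ i ∈ Finset.range M, (f (x i) - (∑ j ∈ Finset.range N, f (x j)) / N) *
      (f (x (i + u)) - (∑ j ∈ Finset.range N, f (x j)) / N) =
      ∑ i ∈ Finset.range M, g (x i) * g (x (i + u)) -
        (∑ j ∈ Finset.range N, g (x j)) / N *
          (∑ i ∈ Finset.range M, g (x i) + ∑ i ∈ Finset.range M, g (x (i + u))) +
        M * ((∑ j ∈ Finset.range N, g (x j)) / N) ^ 2 := by
    intro x
    rw [hbar x, ← lagSum_centred_eq (fun i => g (x i)) ((∑ j ∈ Finset.range N, g (x j)) / N) M u]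
    refine Finset.sum_congr rfl fun i _ => ?_
    simp only [hgdef]
    ring
  simp_rw [hpt]
  have hI2 : ∀ i j, Integrable (fun x : ℕ → Ω => g (x i) * g (x j)) P := fun i j =>
    integrable_of_bounded P ((hgm.comp (measurable_pi_apply i)).mul (hgm.comp (measurable_pi_apply j)))
      (C := (C + |m|) * (C + |m|)) fun x => by
        rw [abs_mul]; exact mul_le_mul (hgb (x i)) (hgb (x j)) (abs_nonneg _) ((abs_nonneg _).trans (hgb (x i)))
  have hA : Integrable (fun x : ℕ → Ω => ∑ i ∈ Finset.range M, g (x i) * g (x (i + u))) P :=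
    integrable_finsetSum _ fun i _ => hI2 i (i + u)
  have hcross : ∀ x : ℕ → Ω, (∑ j ∈ Finset.range N, g (x j)) / N *
      (∑ i ∈ Finset.range M, g (x i) + ∑ i ∈ Finset.range M, g (x (i + u))) =
      (∑ i ∈ Finset.range M, ∑ k ∈ Finset.range N, (g (x i) * g (x k) + g (x (i + u)) * g (x k))) / N := by
    intro x
    rw [div_mul_eq_mul_div]
    congr 1
    rw [mul_add, Finset.mul_sum, Finset.mul_sum, ← Finset.sum_add_distrib]
    refine Finset.sum_congr rfl fun i _ => ?_
    rw [Finset.sum_add_distrib, Finset.sum_mul, Finset.sum_mul]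
    congr 1 <;> exact Finset.sum_congr rfl fun k _ => by ring
  simp_rw [hcross]
  have hIk : ∀ i k, Integrable (fun x : ℕ → Ω => g (x i) * g (x k) + g (x (i + u)) * g (x k)) P :=
    fun i k => (hI2 i k).add (hI2 (i + u) k)
  have hIrow : ∀ i, Integrable (fun x : ℕ → Ω => ∑ k ∈ Finset.range N,
      (g (x i) * g (x k) + g (x (i + u)) * g (x k))) P := fun i => integrable_finsetSum _ fun k _ => hIk i k
  have hB : Integrable (fun x : ℕ → Ω => (∑ i ∈ Finset.range M, ∑ k ∈ Finset.range N,
      (g (x i) * g (x k) + g (x (i + u)) * g (x k))) / N) P :=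
    (integrable_finsetSum _ fun i _ => hIrow i).div_const _
  have hsq : ∀ x : ℕ → Ω, (M : ℝ) * ((∑ j ∈ Finset.range N, g (x j)) / N) ^ 2 =
      M * ((∑ j ∈ Finset.range N, f (x j)) / N - m) ^ 2 := by
    intro x; rw [hbar x]; ring
  simp_rw [hsq]
  have hCm : Measurable fun x : ℕ → Ω => ((∑ j ∈ Finset.range N, f (x j)) / N - m) ^ 2 :=
    (((Finset.measurable_sum _ fun j _ => hf.comp (measurable_pi_apply j)).div_const _).sub
      measurable_const).pow_const 2
  have hCint : Integrable (fun x : ℕ → Ω => (M : ℝ) * ((∑ j ∈ Finset.range N, f (x j)) / N - m) ^ 2) P := by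
    refine (integrable_of_bounded P hCm (C := (C + |m|) ^ 2) fun x => ?_).const_mul _
    rw [abs_pow]
    exact pow_le_pow_left₀ (abs_nonneg _) ((abs_sub _ _).trans (add_le_add (abs_timeAverage_le hC hN x) le_rfl)) 2
  have h1 : ∫ x, ∑ i ∈ Finset.range M, g (x i) * g (x (i + u)) ∂P =
      ∑ i ∈ Finset.range M, ∫ x, g (x i) * g (x (i + u)) ∂P := integral_finsetSum _ fun i _ => hI2 i (i + u)
  have h2 : ∫ x, (∑ i ∈ Finset.range M, ∑ k ∈ Finset.range N,
      (g (x i) * g (x k) + g (x (i + u)) * g (x k))) / N ∂P =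
      (∑ i ∈ Finset.range M, ∑ k ∈ Finset.range N,
        (∫ x, g (x i) * g (x k) ∂P + ∫ x, g (x (i + u)) * g (x k) ∂P)) / N := by
    rw [integral_div, integral_finsetSum _ fun i _ => hIrow i]
    congr 1
    refine Finset.sum_congr rfl fun i _ => ?_
    rw [integral_finsetSum _ fun k _ => hIk i k]
    refine Finset.sum_congr rfl fun k _ => ?_
    rw [integral_add (hI2 i k) (hI2 (i + u) k)]
  have h3 : ∫ x, (M : ℝ) * ((∑ j ∈ Finset.range N, f (x j)) / N - m) ^ 2 ∂P =
      M * ∫ x, ((∑ j ∈ Finset.range N, f (x j)) / N - m) ^ 2 ∂P := integral_const_mul _ _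
  have hAB : Integrable (fun x : ℕ → Ω => ∑ i ∈ Finset.range M, g (x i) * g (x (i + u)) -
      (∑ i ∈ Finset.range M, ∑ k ∈ Finset.range N, (g (x i) * g (x k) + g (x (i + u)) * g (x k))) / N) P :=
    hA.sub hB
  rw [integral_add hAB hCint, integral_sub hA hB, h1, h2, h3]

/-! ## §2 Flow-MCMC from the mode: the cold start moves the lag sum by `O((δ² + V)·w)` -/

omit [MeasurableSpace Ω] in
/-- `min i j + |i − j| = max i j`. [ours, arithmetic] -/
theorem min_add_dist_eq_max (i j : ℕ) : min i j + Nat.dist i j = max i j := by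
  rcases le_total i j with h | h
  · rw [min_eq_left h, max_eq_right h, Nat.dist_eq_sub_of_le h]; omega
  · rw [min_eq_right h, max_eq_left h, Nat.dist_eq_sub_of_le_right h]; omega

omit [MeasurableSpace Ω] in
/-- `|a − b + c − (a' − b' + c')| ≤ x + y + z` from the three termwise bounds. [ours, bookkeeping] -/
theorem abs_sub_three_le {a b c a' b' c' x y z : ℝ} (ha : |a - a'| ≤ x) (hb : |b - b'| ≤ y)
    (hc : |c - c'| ≤ z) : |a - b + c - (a' - b' + c')| ≤ x + y + z := by
  have h1 : |a - b + c - (a' - b' + c')| = |(a - a') - (b - b') + (c - c')| := by congr 1; ring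
  rw [h1]
  refine (abs_add_le _ _).trans ?_
  have h2 := abs_sub (a - a') (b - b')
  linarith

variable [MeasurableSingletonClass Ω] {q : Measure Ω} [IsProbabilityMeasure q] {w : Ω → ℝ}

/-- **The cold-started pair moment against the equilibrium one**: `|E_{x₀}[f̄(X_i)f̄(X_j)] − γ_{|i−j|}| ≤ (δ² + V)·r^{max(i,j)}`
(GEN-32's pair law `E_{x₀}[f̄_i f̄_j] = (1 − r^{min})γ_{|i−j|} + r^{max}δ²` with `0 ≤ γ_u ≤ r^u V`). [ours] -/
theorem imh_chain_pair_mode_sub_stationary_abs_le [Fact (Measurable w)] (hw0 : ∀ y, 0 < w y) {x₀ : Ω}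
    (hmax : ∀ y, w y ≤ w x₀) [IsProbabilityMeasure (q.withDensity fun y => ENNReal.ofReal (w y))]
    {f : Ω → ℝ} (hf : Measurable f) {C : ℝ} (hC : ∀ x, |f x| ≤ C) (i j : ℕ) :
    |∫ x, (f (x i) - ∫ z, f z ∂(q.withDensity fun y => ENNReal.ofReal (w y))) *
          (f (x j) - ∫ z, f z ∂(q.withDensity fun y => ENNReal.ofReal (w y)))
          ∂(Kernel.trajMeasure (X := fun _ : ℕ => Ω) (Measure.dirac x₀)
            (fun n : ℕ => (indepMH q w).comap (fun h : (i : ↥(Finset.Iic n)) → Ω => h ⟨n, Finset.mem_Iic.2 le_rfl⟩)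
              (measurable_pi_apply _))) -
        ∫ x, (f (x i) - ∫ z, f z ∂(q.withDensity fun y => ENNReal.ofReal (w y))) *
          (f (x j) - ∫ z, f z ∂(q.withDensity fun y => ENNReal.ofReal (w y)))
          ∂(Kernel.trajMeasure (X := fun _ : ℕ => Ω) (q.withDensity fun y => ENNReal.ofReal (w y))
            (fun n : ℕ => (indepMH q w).comap (fun h : (i : ↥(Finset.Iic n)) → Ω => h ⟨n, Finset.mem_Iic.2 le_rfl⟩)
              (measurable_pi_apply _)))| ≤
      ((f x₀ - ∫ z, f z ∂(q.withDensity fun y => ENNReal.ofReal (w y))) ^ 2 +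
          ∫ x, (f x - ∫ z, f z ∂(q.withDensity fun y => ENNReal.ofReal (w y))) ^ 2
            ∂(q.withDensity fun y => ENNReal.ofReal (w y))) *
        (1 - (w x₀)⁻¹) ^ max i j := by
  have hw : Measurable w := Fact.out
  have hW : 1 ≤ w x₀ := one_le_of_mode (q := q) hmax
  have hr0 : 0 ≤ 1 - (w x₀)⁻¹ := sub_nonneg.2 (inv_le_one_of_one_le₀ hW)
  have hr1 : 1 - (w x₀)⁻¹ ≤ 1 := sub_le_self _ (inv_nonneg.2 (hw0 x₀).le)
  have hπK : Kernel.Invariant (indepMH q w) (q.withDensity fun y => ENNReal.ofReal (w y)) :=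
    indepMH_invariant (q := q) hw hw0
  obtain ⟨hgm, hgb, -⟩ := centred_facts (q := q) (w := w) hf hC
  obtain ⟨hγ0, hγle⟩ := imh_autocov_centred_bounds (q := q) hw hw0 hmax hf hC (Nat.dist i j) (x₀ := x₀)
  rw [imh_chain_pair_mode hw0 hmax hf hC i j, chain_pair_stationary (indepMH q w) hπK hgm hgb i j]
  set γd := autocov (indepMH q w) (q.withDensity fun y => ENNReal.ofReal (w y))
      (fun x => f x - ∫ z, f z ∂(q.withDensity fun y => ENNReal.ofReal (w y))) (Nat.dist i j) with hγd
  set V := ∫ x, (f x - ∫ z, f z ∂(q.withDensity fun y => ENNReal.ofReal (w y))) ^ 2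
      ∂(q.withDensity fun y => ENNReal.ofReal (w y)) with hV
  set D := (f x₀ - ∫ z, f z ∂(q.withDensity fun y => ENNReal.ofReal (w y))) ^ 2 with hD
  have hmax' : (1 - (w x₀)⁻¹) ^ min i j * (1 - (w x₀)⁻¹) ^ Nat.dist i j = (1 - (w x₀)⁻¹) ^ max i j := by
    rw [← pow_add, min_add_dist_eq_max]
  have hkey : (1 - (1 - (w x₀)⁻¹) ^ min i j) * γd + (1 - (w x₀)⁻¹) ^ max i j * D - γd =
      -((1 - (w x₀)⁻¹) ^ min i j * γd) + (1 - (w x₀)⁻¹) ^ max i j * D := by ring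
  rw [hkey]
  have h1 : (1 - (w x₀)⁻¹) ^ min i j * γd ≤ (1 - (w x₀)⁻¹) ^ max i j * V := by
    calc (1 - (w x₀)⁻¹) ^ min i j * γd ≤ (1 - (w x₀)⁻¹) ^ min i j * ((1 - (w x₀)⁻¹) ^ Nat.dist i j * V) :=
          mul_le_mul_of_nonneg_left hγle (pow_nonneg hr0 _)
      _ = (1 - (w x₀)⁻¹) ^ max i j * V := by rw [← mul_assoc, hmax']
  have h2 : 0 ≤ (1 - (w x₀)⁻¹) ^ min i j * γd := mul_nonneg (pow_nonneg hr0 _) hγ0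
  have h3 : 0 ≤ (1 - (w x₀)⁻¹) ^ max i j * D := mul_nonneg (pow_nonneg hr0 _) (sq_nonneg _)
  rw [abs_le]
  constructor <;> nlinarith

/-- **THE COLD START MOVES THE Γ-METHOD'S LAG SUM BY AT MOST `(δ² + V)(w + 3(2w² − w)/N)`**: for flow-MCMC from the
mode, every lag `u` and every `N ≥ 1`, `|E_{x₀}[S_u] − E_π[S_u]| ≤ (δ² + V)·(w + 3(2w² − w)/N)`. [ours] -/
theorem imh_chain_lagSum_centred_mode_sub_stationary_abs_le [Fact (Measurable w)] (hw0 : ∀ y, 0 < w y) {x₀ : Ω}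
    (hmax : ∀ y, w y ≤ w x₀) [IsProbabilityMeasure (q.withDensity fun y => ENNReal.ofReal (w y))]
    {f : Ω → ℝ} (hf : Measurable f) {C : ℝ} (hC : ∀ x, |f x| ≤ C) {N : ℕ} (hN : N ≠ 0) (u : ℕ) :
    |∫ x, ∑ i ∈ Finset.range (N - u), (f (x i) - (∑ j ∈ Finset.range N, f (x j)) / N) *
          (f (x (i + u)) - (∑ j ∈ Finset.range N, f (x j)) / N)
          ∂(Kernel.trajMeasure (X := fun _ : ℕ => Ω) (Measure.dirac x₀)
            (fun n : ℕ => (indepMH q w).comap (fun h : (i : ↥(Finset.Iic n)) → Ω => h ⟨n, Finset.mem_Iic.2 le_rfl⟩)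
              (measurable_pi_apply _))) -
      ∫ x, ∑ i ∈ Finset.range (N - u), (f (x i) - (∑ j ∈ Finset.range N, f (x j)) / N) *
          (f (x (i + u)) - (∑ j ∈ Finset.range N, f (x j)) / N)
          ∂(Kernel.trajMeasure (X := fun _ : ℕ => Ω) (q.withDensity fun y => ENNReal.ofReal (w y))
            (fun n : ℕ => (indepMH q w).comap (fun h : (i : ↥(Finset.Iic n)) → Ω => h ⟨n, Finset.mem_Iic.2 le_rfl⟩)
              (measurable_pi_apply _)))| ≤
      ((f x₀ - ∫ z, f z ∂(q.withDensity fun y => ENNReal.ofReal (w y))) ^ 2 +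
          ∫ x, (f x - ∫ z, f z ∂(q.withDensity fun y => ENNReal.ofReal (w y))) ^ 2
            ∂(q.withDensity fun y => ENNReal.ofReal (w y))) *
        (w x₀ + 3 * (2 * w x₀ ^ 2 - w x₀) / N) := by
  have hw : Measurable w := Fact.out
  have hW : 1 ≤ w x₀ := one_le_of_mode (q := q) hmax
  have hr0 : 0 ≤ 1 - (w x₀)⁻¹ := sub_nonneg.2 (inv_le_one_of_one_le₀ hW)
  have hr1 : 1 - (w x₀)⁻¹ ≤ 1 := sub_le_self _ (inv_nonneg.2 (hw0 x₀).le)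
  have hNpos : (0 : ℝ) < N := by exact_mod_cast Nat.pos_of_ne_zero hN
  have hMN : ((N - u : ℕ) : ℝ) ≤ N := by exact_mod_cast Nat.sub_le N u
  have hM0 : (0 : ℝ) ≤ (N - u : ℕ) := Nat.cast_nonneg _
  set m := ∫ z, f z ∂(q.withDensity fun y => ENNReal.ofReal (w y)) with hm
  rw [chain_lagSum_centred_eq_pairs (indepMH q w) (Measure.dirac x₀) hf hC m hN u,
    chain_lagSum_centred_eq_pairs (indepMH q w) (q.withDensity fun y => ENNReal.ofReal (w y)) hf hC m hN u]
  set P0 := Kernel.trajMeasure (X := fun _ : ℕ => Ω) (Measure.dirac x₀)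
      (fun n : ℕ => (indepMH q w).comap (fun h : (i : ↥(Finset.Iic n)) → Ω => h ⟨n, Finset.mem_Iic.2 le_rfl⟩)
        (measurable_pi_apply _)) with hP0
  set Pπ := Kernel.trajMeasure (X := fun _ : ℕ => Ω) (q.withDensity fun y => ENNReal.ofReal (w y))
      (fun n : ℕ => (indepMH q w).comap (fun h : (i : ↥(Finset.Iic n)) → Ω => h ⟨n, Finset.mem_Iic.2 le_rfl⟩)
        (measurable_pi_apply _)) with hPπ
  set D := (f x₀ - m) ^ 2 with hD
  set V := ∫ x, (f x - m) ^ 2 ∂(q.withDensity fun y => ENNReal.ofReal (w y)) with hV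
  have hV0 : 0 ≤ V := integral_nonneg fun x => sq_nonneg _
  have hDV : 0 ≤ D + V := add_nonneg (sq_nonneg _) hV0
  -- pointwise envelope of the pair-moment difference
  have hΔ : ∀ i j, |(∫ x, (f (x i) - m) * (f (x j) - m) ∂P0) - (∫ x, (f (x i) - m) * (f (x j) - m) ∂Pπ)| ≤ (D + V) * (1 - (w x₀)⁻¹) ^ max i j := fun i j => by
    rw [hP0, hPπ, hD, hV, hm]
    exact imh_chain_pair_mode_sub_stationary_abs_le (q := q) hw0 hmax hf hC i j
  -- term 1: the lag-`u` diagonal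
  have hT1 : |∑ i ∈ Finset.range (N - u), (∫ x, (f (x i) - m) * (f (x (i + u)) - m) ∂P0) -
      ∑ i ∈ Finset.range (N - u), (∫ x, (f (x i) - m) * (f (x (i + u)) - m) ∂Pπ)| ≤ (D + V) * w x₀ := by
    rw [← Finset.sum_sub_distrib]
    refine (Finset.abs_sum_le_sum_abs _ _).trans ?_
    calc ∑ i ∈ Finset.range (N - u), |(∫ x, (f (x i) - m) * (f (x (i + u)) - m) ∂P0) - (∫ x, (f (x i) - m) * (f (x (i + u)) - m) ∂Pπ)|
        ≤ ∑ i ∈ Finset.range (N - u), (D + V) * (1 - (w x₀)⁻¹) ^ i := by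
          refine Finset.sum_le_sum fun i _ => (hΔ i (i + u)).trans ?_
          refine mul_le_mul_of_nonneg_left ?_ hDV
          rw [max_eq_right (Nat.le_add_right i u)]
          exact pow_le_pow_of_le_one hr0 hr1 (Nat.le_add_right i u)
      _ = (D + V) * ∑ i ∈ Finset.range (N - u), (1 - (w x₀)⁻¹) ^ i := by rw [Finset.mul_sum]
      _ ≤ (D + V) * w x₀ := mul_le_mul_of_nonneg_left (geom_sum_mode_le_weight (q := q) hw0 hmax _) hDV
  -- term 2: the cross double sum
  have hT2 : |∑ i ∈ Finset.range (N - u), ∑ k ∈ Finset.range N, ((∫ x, (f (x i) - m) * (f (x k) - m) ∂P0) + (∫ x, (f (x (i + u)) - m) * (f (x k) - m) ∂P0)) -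
      ∑ i ∈ Finset.range (N - u), ∑ k ∈ Finset.range N, ((∫ x, (f (x i) - m) * (f (x k) - m) ∂Pπ) + (∫ x, (f (x (i + u)) - m) * (f (x k) - m) ∂Pπ))| ≤
      2 * (D + V) * (2 * w x₀ ^ 2 - w x₀) := by
    rw [← Finset.sum_sub_distrib]
    refine (Finset.abs_sum_le_sum_abs _ _).trans ?_
    have hrow : ∀ i ∈ Finset.range (N - u), |∑ k ∈ Finset.range N, ((∫ x, (f (x i) - m) * (f (x k) - m) ∂P0) + (∫ x, (f (x (i + u)) - m) * (f (x k) - m) ∂P0)) -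
        ∑ k ∈ Finset.range N, ((∫ x, (f (x i) - m) * (f (x k) - m) ∂Pπ) + (∫ x, (f (x (i + u)) - m) * (f (x k) - m) ∂Pπ))| ≤
        2 * (D + V) * ∑ k ∈ Finset.range N, (1 - (w x₀)⁻¹) ^ max i k := by
      intro i _
      rw [← Finset.sum_sub_distrib, Finset.mul_sum]
      refine (Finset.abs_sum_le_sum_abs _ _).trans (Finset.sum_le_sum fun k _ => ?_)
      have h1 := hΔ i k
      have h2 := hΔ (i + u) k
      have h3 : (1 - (w x₀)⁻¹) ^ max (i + u) k ≤ (1 - (w x₀)⁻¹) ^ max i k :=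
        pow_le_pow_of_le_one hr0 hr1 (max_le_max (Nat.le_add_right i u) le_rfl)
      calc |(∫ x, (f (x i) - m) * (f (x k) - m) ∂P0) + (∫ x, (f (x (i + u)) - m) * (f (x k) - m) ∂P0) - ((∫ x, (f (x i) - m) * (f (x k) - m) ∂Pπ) + (∫ x, (f (x (i + u)) - m) * (f (x k) - m) ∂Pπ))|
          = |((∫ x, (f (x i) - m) * (f (x k) - m) ∂P0) - (∫ x, (f (x i) - m) * (f (x k) - m) ∂Pπ)) + ((∫ x, (f (x (i + u)) - m) * (f (x k) - m) ∂P0) - (∫ x, (f (x (i + u)) - m) * (f (x k) - m) ∂Pπ))| := by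
            congr 1; ring
        _ ≤ |(∫ x, (f (x i) - m) * (f (x k) - m) ∂P0) - (∫ x, (f (x i) - m) * (f (x k) - m) ∂Pπ)| + |(∫ x, (f (x (i + u)) - m) * (f (x k) - m) ∂P0) - (∫ x, (f (x (i + u)) - m) * (f (x k) - m) ∂Pπ)| := abs_add_le _ _
        _ ≤ (D + V) * (1 - (w x₀)⁻¹) ^ max i k + (D + V) * (1 - (w x₀)⁻¹) ^ max i k :=
            add_le_add h1 (h2.trans (mul_le_mul_of_nonneg_left h3 hDV))
        _ = 2 * (D + V) * (1 - (w x₀)⁻¹) ^ max i k := by ring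
    refine (Finset.sum_le_sum hrow).trans ?_
    rw [← Finset.mul_sum]
    refine mul_le_mul_of_nonneg_left ?_ (by positivity)
    -- enlarge the `i`-range to `N` and use the pair count `Σ_{i,k<N} r^{max} = Σ_k (2k+1) r^k ≤ 2w² − w`
    have hsub : Finset.range (N - u) ⊆ Finset.range N := Finset.range_subset_range.2 (Nat.sub_le N u)
    calc ∑ i ∈ Finset.range (N - u), ∑ k ∈ Finset.range N, (1 - (w x₀)⁻¹) ^ max i k
        ≤ ∑ i ∈ Finset.range N, ∑ k ∈ Finset.range N, (1 - (w x₀)⁻¹) ^ max i k :=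
          Finset.sum_le_sum_of_subset_of_nonneg hsub fun i _ _ => Finset.sum_nonneg fun k _ => pow_nonneg hr0 _
      _ = ∑ k ∈ Finset.range N, (2 * (k : ℝ) + 1) * (1 - (w x₀)⁻¹) ^ k := sum_sum_max _ N
      _ ≤ 2 * w x₀ ^ 2 - w x₀ := oddPowSum_le_mode (q := q) hw0 hmax N
  -- term 3: the squared-mean terms, by GEN-32's two-sided second-order bounds
  have hMSEhi := imh_chain_mse_mode_le_stationary_add (q := q) hw0 hmax hf hC hN (x₀ := x₀)
  have hMSElo := imh_chain_mse_mode_ge_stationary_sub (q := q) hw0 hmax hf hC hN (x₀ := x₀)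
  rw [← hm, ← hP0, ← hPπ] at hMSEhi hMSElo
  have hN2 : (0 : ℝ) < (N : ℝ) ^ 2 := by positivity
  have hB : 0 ≤ 2 * w x₀ ^ 2 - w x₀ := by nlinarith
  have hT3 : |((N - u : ℕ) : ℝ) * ∫ x, ((∑ j ∈ Finset.range N, f (x j)) / N - m) ^ 2 ∂P0 -
      (N - u : ℕ) * ∫ x, ((∑ j ∈ Finset.range N, f (x j)) / N - m) ^ 2 ∂Pπ| ≤
      (2 * w x₀ ^ 2 - w x₀) * (D + V) / N := by
    rw [← mul_sub, abs_mul, abs_of_nonneg hM0]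
    have hdiff : |∫ x, ((∑ j ∈ Finset.range N, f (x j)) / N - m) ^ 2 ∂P0 -
        ∫ x, ((∑ j ∈ Finset.range N, f (x j)) / N - m) ^ 2 ∂Pπ| ≤ (2 * w x₀ ^ 2 - w x₀) * (D + V) / (N : ℝ) ^ 2 := by
      rw [abs_le]
      constructor
      · have h : (2 * w x₀ ^ 2 - w x₀) * V / (N : ℝ) ^ 2 ≤ (2 * w x₀ ^ 2 - w x₀) * (D + V) / (N : ℝ) ^ 2 :=
          div_le_div_of_nonneg_right (by nlinarith [sq_nonneg (f x₀ - m)]) hN2.le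
        linarith
      · have h : (2 * w x₀ ^ 2 - w x₀) * D / (N : ℝ) ^ 2 ≤ (2 * w x₀ ^ 2 - w x₀) * (D + V) / (N : ℝ) ^ 2 :=
          div_le_div_of_nonneg_right (by nlinarith [hV0]) hN2.le
        linarith
    calc ((N - u : ℕ) : ℝ) * |∫ x, ((∑ j ∈ Finset.range N, f (x j)) / N - m) ^ 2 ∂P0 -
          ∫ x, ((∑ j ∈ Finset.range N, f (x j)) / N - m) ^ 2 ∂Pπ|
        ≤ N * ((2 * w x₀ ^ 2 - w x₀) * (D + V) / (N : ℝ) ^ 2) :=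
          mul_le_mul hMN hdiff (abs_nonneg _) hNpos.le
      _ = (2 * w x₀ ^ 2 - w x₀) * (D + V) / N := by field_simp
  -- assemble
  have hT2' : |(∑ i ∈ Finset.range (N - u), ∑ k ∈ Finset.range N, ((∫ x, (f (x i) - m) * (f (x k) - m) ∂P0) + (∫ x, (f (x (i + u)) - m) * (f (x k) - m) ∂P0))) / N -
      (∑ i ∈ Finset.range (N - u), ∑ k ∈ Finset.range N, ((∫ x, (f (x i) - m) * (f (x k) - m) ∂Pπ) + (∫ x, (f (x (i + u)) - m) * (f (x k) - m) ∂Pπ))) / N| ≤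
      2 * (D + V) * (2 * w x₀ ^ 2 - w x₀) / N := by
    rw [← sub_div, abs_div, abs_of_pos hNpos]
    exact div_le_div_of_nonneg_right hT2 hNpos.le
  refine (abs_sub_three_le hT1 hT2' hT3).trans (le_of_eq ?_)
  field_simp
  ring

/-- **THE COLD START BIASES THE AUTOCOVARIANCE ESTIMATOR `Γ̂_u = S_u/N` BY AT MOST `(δ² + V)(w + 3(2w² − w)/N)/N`** —
`O(w(δ² + V)/N)` at every lag, the same order as its own equilibrium bias. [ours] -/
theorem imh_chain_empiricalAutocov_mode_abs_le [Fact (Measurable w)] (hw0 : ∀ y, 0 < w y) {x₀ : Ω}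
    (hmax : ∀ y, w y ≤ w x₀) [IsProbabilityMeasure (q.withDensity fun y => ENNReal.ofReal (w y))]
    {f : Ω → ℝ} (hf : Measurable f) {C : ℝ} (hC : ∀ x, |f x| ≤ C) {N : ℕ} (hN : N ≠ 0) (u : ℕ) :
    |(∫ x, ∑ i ∈ Finset.range (N - u), (f (x i) - (∑ j ∈ Finset.range N, f (x j)) / N) *
          (f (x (i + u)) - (∑ j ∈ Finset.range N, f (x j)) / N)
          ∂(Kernel.trajMeasure (X := fun _ : ℕ => Ω) (Measure.dirac x₀)
            (fun n : ℕ => (indepMH q w).comap (fun h : (i : ↥(Finset.Iic n)) → Ω => h ⟨n, Finset.mem_Iic.2 le_rfl⟩)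
              (measurable_pi_apply _)))) / N -
      (∫ x, ∑ i ∈ Finset.range (N - u), (f (x i) - (∑ j ∈ Finset.range N, f (x j)) / N) *
          (f (x (i + u)) - (∑ j ∈ Finset.range N, f (x j)) / N)
          ∂(Kernel.trajMeasure (X := fun _ : ℕ => Ω) (q.withDensity fun y => ENNReal.ofReal (w y))
            (fun n : ℕ => (indepMH q w).comap (fun h : (i : ↥(Finset.Iic n)) → Ω => h ⟨n, Finset.mem_Iic.2 le_rfl⟩)
              (measurable_pi_apply _)))) / N| ≤
      ((f x₀ - ∫ z, f z ∂(q.withDensity fun y => ENNReal.ofReal (w y))) ^ 2 +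
          ∫ x, (f x - ∫ z, f z ∂(q.withDensity fun y => ENNReal.ofReal (w y))) ^ 2
            ∂(q.withDensity fun y => ENNReal.ofReal (w y))) *
        (w x₀ + 3 * (2 * w x₀ ^ 2 - w x₀) / N) / N := by
  have hNpos : (0 : ℝ) < N := by exact_mod_cast Nat.pos_of_ne_zero hN
  rw [← sub_div, abs_div, abs_of_pos hNpos]
  exact div_le_div_of_nonneg_right (imh_chain_lagSum_centred_mode_sub_stationary_abs_le hw0 hmax hf hC hN u) hNpos.le

end Summit.Ventures.LatticeQCDFlow.Exactness
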